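import Literature.NumberTheory.Automorphic.SymplecticSatakeSiegelDescent
import Literature.NumberTheory.Automorphic.SymplecticSatakeKlingenDescent
import Literature.NumberTheory.Automorphic.SymplecticBorelModulusIndex
import HarnessLib

/-!
# Weyl-group invariance of the Satake transform of `Sp_{2n}` in every rank: `𝒮_q(T)` is invariant under all signed
# permutations of the exponents (Satake 1963 §7; Cartier 1979 §IV Thm. 4.1 (b); Andrianov–Zhuravlev Thm. 3.30)

Topic `NumberTheory/Automorphic`; namespace `Literature.NumberTheory.Automorphic.SymplecticCartan` (lane `lit-hodgefound`,
Track 2 foundations; seat `lit-hodgefound-p11`, generation 50, row g50-#5).  DEFINITIONS with bodies (`signedPermEquiv`,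
`symplecticWeylGroup`) + theorems; no named fact, no instance, no notation.  Assembles `SymplecticSatakeSiegelDescent` (g50-#2:
`S_n`-invariance), `SymplecticSatakeKlingenDescent` (g50-#4: the induction step along the Klingen parabolic) and the tree's
`w₀`-symmetry `coeff_symplecticSatakeTransform_neg` (`SymplecticBorelModulusIndex`, g45-#4).

## The mathematics

`G = Sp_{2n}(K)` (`K` a field with `Valued K ℤᵐ⁰`, compact `𝒪`, finite residue field of cardinality `q`), `K₀ = Sp_{2n}(𝒪)`
(hyperspecial), `Λ = X_*(A) = ℤⁿ`.  The Weyl group of `Sp_{2n}` is the hyperoctahedral group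
`W(C_n) = (ℤ/2)^n ⋊ S_n` of SIGNED PERMUTATIONS `μ ↦ (ε_i μ_{π(i)})_i` (`ε ∈ {±1}ⁿ`, `π ∈ S_n`) of `ℤⁿ` ([Satake1963] §7;
[BruhatTits1972] (4.4.3)).  THEOREM (Satake; [CartierCorvallis1979] Thm. 4.1 (b) «the image of `S` is contained in
`ℂ[X_*(A)]^W`»; [AndrianovZhuravlev1995] Ch. 3 Thm. 3.30 (`Ω` maps onto the `W`-symmetric polynomials)): for every
commutative ring `R` in which the residue cardinality is a unit `q`, every `T ∈ ℋ_R(G, K₀)`, every `ε`, `π` and `μ ∈ ℤⁿ`,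

  **`𝒮_q(T)_{(ε_i μ_{π i})_i} = 𝒮_q(T)_μ`**,   i.e. `𝒮_q(ℋ_R) ⊆ R[ℤⁿ]^{W(C_n)}`.

PROOF (Cartier's (b): reduction to the maximal parabolics, by induction on `n`).  `W(C_n)` is generated by (1) the
permutations — the Siegel descent to `GL_n` (`coeff_symplecticSatakeTransform_comp_perm_of_valued`); (2) `w₀ = -1` — the
duality of the tree (`coeff_symplecticSatakeTransform_neg`); (3) `{1} × W(C_{n-1})` acting on the last `n - 1` coordinates —
the Klingen descent (`coeff_symplecticSatakeTransform_cons_eq_of_forall`) and the induction hypothesis for `Sp_{2n-2}(K)`.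
Indeed a sign vector `ε` with `ε₀ = 1` is handled by (3), one with `ε₀ = -1` by (2) applied to `-ε`, and the permutation is
moved to the other side by (1).  No square root of `q`: `Sp_{2n}` is simply connected (`ρ ∈ X^*(A)`).

## What is formalised

* §1 (bookkeeping of sign vectors), **`coeff_symplecticSatakeTransform_sign_mul`** (`(ε_i μ_i)_i`, by
  induction on `n`), **`coeff_symplecticSatakeTransform_signedPerm`** (THE THEOREM, `(ε_i μ_{π i})_i`).
* §2 **`signedPermEquiv ε π : ℤⁿ ≃ₗ[ℤ] ℤⁿ`**, `signedPermEquiv_apply`, **`symplecticWeylGroup n ≤ Aut_ℤ(ℤⁿ)`** (`W(C_n)`),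
  `funCongrLeft_mem_symplecticWeylGroup`, `neg_mem_symplecticWeylGroup`, **`symplecticSatakeTransform_mem_weylInvariants`**
  (`𝒮_q(T) ∈ R[ℤⁿ]^{W(C_n)}`, the tree's `weylInvariants`), `range_symplecticSatakeTransform_le_weylInvariants`.

## References
* [Satake1963] I. Satake, *Theory of spherical functions on reductive algebraic groups over 𝔭-adic fields*, Publ. Math. IHÉS 18
  (1963), §7 (`Sp_n`: the Weyl group of signed permutations), §8.3.
* [CartierCorvallis1979] P. Cartier, *Representations of 𝔭-adic groups: a survey*, PSPM 33.1 (1979), §IV (4.2), Thm. 4.1 and its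
  proof (b).
* [AndrianovZhuravlev1995] A. N. Andrianov, V. G. Zhuravlev, *Modular Forms and Hecke Operators*, Transl. Math. Monogr. 145
  (1995), Ch. 3 §3.3 (3.44)–(3.49), Thm. 3.30.
* [BruhatTits1972] F. Bruhat, J. Tits, *Groupes réductifs sur un corps local I*, Publ. Math. IHÉS 41 (1972), (4.4.3), Prop. (4.4.4).
* [Macdonald1971] I. G. Macdonald, *Spherical functions on a group of p-adic type*, Madras (1971), Ch. IV, V.
-/

noncomputable section

open scoped Valued WithZero MatrixGroups
open Matrix MonoidAlgebra Representation

namespace Literature.NumberTheory.Automorphic.SymplecticCartan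

open Literature.NumberTheory.Automorphic Literature.NumberTheory.Automorphic.HermitianLattice

variable {K : Type*} [Field K] [Valued K ℤᵐ⁰] {ϖ : K} {R : Type*} [CommRing R]

/-! ## §1 Invariance under signed permutations, by induction on the rank -/

omit [Valued K ℤᵐ⁰] in
/-- A sign vector with `ε₀ = 1` acts through its tail: `(ε_i μ_i)_i = (μ₀ ; (ε_{j+1} μ_{j+1})_j)`. [folklore] -/
private theorem sign_mul_eq_cons_of_head_eq_one {m : ℕ} (ε : Fin (m + 1) → ℤˣ) (hε : ε 0 = 1) (μ : Fin (m + 1) → ℤ) :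
    (fun i => (ε i : ℤ) * μ i) = Fin.cons (μ 0) (fun j => (ε j.succ : ℤ) * μ j.succ) := by
  funext i
  refine Fin.cases ?_ (fun j => ?_) i
  · rw [Fin.cons_zero, hε, Units.val_one, one_mul]
  · rw [Fin.cons_succ]

omit [Valued K ℤᵐ⁰] in
/-- A unit of `ℤ` other than `1` is `-1`. [folklore] -/
private theorem units_int_eq_neg_one_of_ne_one {u : ℤˣ} (hu : u ≠ 1) : u = -1 :=
  (Int.units_eq_one_or u).resolve_left hu

omit [Valued K ℤᵐ⁰] in
/-- Negating a sign vector: `((-ε)_i μ_i)_i = -((ε_i μ_i)_i)`. [folklore] -/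
private theorem neg_sign_mul {n : ℕ} (ε : Fin n → ℤˣ) (μ : Fin n → ℤ) :
    (fun i => ((-ε i : ℤˣ) : ℤ) * μ i) = -(fun i => (ε i : ℤ) * μ i) := by
  funext i
  rw [Pi.neg_apply, Units.val_neg, neg_mul]

/-- Sign changes with `ε₀ = 1`, given the full sign-change invariance in rank `m`. [cite: CartierCorvallis1979, §IV Thm. 4.1, proof (b)] -/
private theorem coeff_sign_mul_of_head_eq_one {m : ℕ} (hϖ : Valued.v ϖ = WithZero.exp (-1 : ℤ)) (q : Rˣ)
    (ih : ∀ (T' : heckeAlgebra R (symplecticGroup (Fin m) K) (symplecticInt (Fin m) K)) (ε' : Fin m → ℤˣ) (μ' : Fin m → ℤ),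
      (symplecticSatakeTransform hϖ q T').coeff (fun j => (ε' j : ℤ) * μ' j) = (symplecticSatakeTransform hϖ q T').coeff μ')
    (T : heckeAlgebra R (symplecticGroup (Fin (m + 1)) K) (symplecticInt (Fin (m + 1)) K)) (ε : Fin (m + 1) → ℤˣ) (hε : ε 0 = 1)
    (μ : Fin (m + 1) → ℤ) :
    (symplecticSatakeTransform hϖ q T).coeff (fun i => (ε i : ℤ) * μ i) = (symplecticSatakeTransform hϖ q T).coeff μ := by
  rw [sign_mul_eq_cons_of_head_eq_one ε hε μ]
  conv_rhs => rw [← Fin.cons_self_tail μ]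
  exact coeff_symplecticSatakeTransform_cons_eq_of_forall hϖ q (f := fun μ' : Fin m → ℤ => fun j => (ε j.succ : ℤ) * μ' j)
    (fun T' μ' => ih T' (fun j => ε j.succ) μ') T (μ 0) (Fin.tail μ)

variable [CompactSpace 𝒪[K]] [Finite 𝓀[K]]

/-- **Invariance under sign changes, every rank** (induction on `n` through the Klingen descent; the head sign is absorbed by
the `w₀ = -1` symmetry). [cite: CartierCorvallis1979, §IV Thm. 4.1, proof (b)] [cite: Satake1963, §7] -/
theorem coeff_symplecticSatakeTransform_sign_mul {n : ℕ} (hϖ : Valued.v ϖ = WithZero.exp (-1 : ℤ)) (q : Rˣ)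
    (hq : (q : R) = Nat.card 𝓀[K]) (T : heckeAlgebra R (symplecticGroup (Fin n) K) (symplecticInt (Fin n) K))
    (ε : Fin n → ℤˣ) (μ : Fin n → ℤ) :
    (symplecticSatakeTransform hϖ q T).coeff (fun i => (ε i : ℤ) * μ i) = (symplecticSatakeTransform hϖ q T).coeff μ := by
  induction n with
  | zero =>
    congr 1
    funext i
    exact Fin.elim0 i
  | succ m ih =>
    haveI := isHeckeTriple_symplecticInt (K := K) (l := Fin (m + 1))
    by_cases hε : ε 0 = 1
    · exact coeff_sign_mul_of_head_eq_one hϖ q ih T ε hε μ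
    · have hε' : (-ε) 0 = 1 := by rw [Pi.neg_apply, units_int_eq_neg_one_of_ne_one hε, neg_neg]
      rw [show (fun i => (ε i : ℤ) * μ i) = -(fun i => ((-ε) i : ℤ) * μ i) from by
          rw [show (fun i => (((-ε) i : ℤˣ) : ℤ) * μ i) = fun i => ((-ε i : ℤˣ) : ℤ) * μ i from rfl, neg_sign_mul, neg_neg],
        coeff_symplecticSatakeTransform_neg hϖ q hq, coeff_sign_mul_of_head_eq_one hϖ q ih T (-ε) hε' μ]

/-- **THE WEYL-GROUP INVARIANCE OF THE SATAKE TRANSFORM OF `Sp_{2n}`, EVERY RANK, EVERY COMMUTATIVE COEFFICIENT RING** in which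
the residue cardinality is a unit `q`: for every `T ∈ ℋ_R(Sp_{2n}(K), Sp_{2n}(𝒪))`, every signed permutation `(ε, π) ∈ W(C_n)`
and every `μ ∈ ℤⁿ`, `𝒮_q(T)_{(ε_i μ_{π i})_i} = 𝒮_q(T)_μ`. [cite: Satake1963, §7] [cite: CartierCorvallis1979, §IV Thm. 4.1 (b)]
[cite: AndrianovZhuravlev1995, Ch. 3 §3.3 Thm. 3.30] -/
theorem coeff_symplecticSatakeTransform_signedPerm {n : ℕ} (hϖ : Valued.v ϖ = WithZero.exp (-1 : ℤ)) (q : Rˣ)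
    (hq : (q : R) = Nat.card 𝓀[K]) (T : heckeAlgebra R (symplecticGroup (Fin n) K) (symplecticInt (Fin n) K))
    (ε : Fin n → ℤˣ) (π : Equiv.Perm (Fin n)) (μ : Fin n → ℤ) :
    (symplecticSatakeTransform hϖ q T).coeff (fun i => (ε i : ℤ) * μ (π i)) = (symplecticSatakeTransform hϖ q T).coeff μ := by
  rw [show (fun i => (ε i : ℤ) * μ (π i)) = (fun j => (ε (π.symm j) : ℤ) * μ j) ∘ π from by
      funext i; simp only [Function.comp_apply, Equiv.symm_apply_apply],
    coeff_symplecticSatakeTransform_comp_perm_of_valued hϖ q hq T π, coeff_symplecticSatakeTransform_sign_mul hϖ q hq T]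

/-! ## §2 The Weyl group `W(C_n)` as a group of automorphisms of `ℤⁿ`; `𝒮_q(T) ∈ R[ℤⁿ]^{W(C_n)}` -/

omit [Valued K ℤᵐ⁰] [CompactSpace 𝒪[K]] [Finite 𝓀[K]]

/-- **The signed permutation `(ε, π)` as an automorphism of `ℤⁿ`**: `μ ↦ (ε_i μ_{π i})_i`. [cite: Satake1963, §7]
[cite: BruhatTits1972, (4.4.3)] -/
def signedPermEquiv {n : ℕ} (ε : Fin n → ℤˣ) (π : Equiv.Perm (Fin n)) : (Fin n → ℤ) ≃ₗ[ℤ] (Fin n → ℤ) :=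
  (LinearEquiv.funCongrLeft ℤ ℤ π).trans (LinearEquiv.piCongrRight fun i => DistribMulAction.toLinearEquiv ℤ ℤ (ε i))

/-- `signedPermEquiv ε π μ = (ε_i μ_{π i})_i`. [cite: Satake1963, §7] -/
@[simp] theorem signedPermEquiv_apply {n : ℕ} (ε : Fin n → ℤˣ) (π : Equiv.Perm (Fin n)) (μ : Fin n → ℤ) :
    signedPermEquiv ε π μ = fun i => (ε i : ℤ) * μ (π i) := by
  funext i
  simp [signedPermEquiv, LinearEquiv.trans_apply, LinearEquiv.piCongrRight_apply, DistribMulAction.toLinearEquiv_apply,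
    Units.smul_def, LinearEquiv.funCongrLeft_apply]

/-- **The Weyl group `W(C_n) ≤ Aut_ℤ(ℤⁿ)` of `Sp_{2n}`**: the subgroup generated by the signed permutations (the hyperoctahedral
group `(ℤ/2)^n ⋊ S_n`). [cite: Satake1963, §7] [cite: BruhatTits1972, (4.4.3)] -/
def symplecticWeylGroup (n : ℕ) : Subgroup ((Fin n → ℤ) ≃ₗ[ℤ] (Fin n → ℤ)) :=
  Subgroup.closure (Set.range fun p : (Fin n → ℤˣ) × Equiv.Perm (Fin n) => signedPermEquiv p.1 p.2)

/-- Signed permutations lie in `W(C_n)`. [cite: Satake1963, §7] -/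
theorem signedPermEquiv_mem_symplecticWeylGroup {n : ℕ} (ε : Fin n → ℤˣ) (π : Equiv.Perm (Fin n)) :
    signedPermEquiv ε π ∈ symplecticWeylGroup n :=
  Subgroup.subset_closure ⟨(ε, π), rfl⟩

/-- The coordinate permutations `S_n ≤ W(C_n)`. [cite: Satake1963, §7] -/
theorem funCongrLeft_mem_symplecticWeylGroup {n : ℕ} (π : Equiv.Perm (Fin n)) :
    LinearEquiv.funCongrLeft ℤ ℤ π ∈ symplecticWeylGroup n := by
  have h : LinearEquiv.funCongrLeft ℤ ℤ π = signedPermEquiv (fun _ => 1) π :=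
    LinearEquiv.ext fun μ => by rw [signedPermEquiv_apply]; funext i; simp [LinearEquiv.funCongrLeft_apply]
  rw [h]
  exact signedPermEquiv_mem_symplecticWeylGroup _ _

/-- `w₀ = -1 ∈ W(C_n)`. [cite: Satake1963, §7] [cite: BruhatTits1972, (4.4.3)] -/
theorem neg_mem_symplecticWeylGroup {n : ℕ} : LinearEquiv.neg ℤ (M := Fin n → ℤ) ∈ symplecticWeylGroup n := by
  have h : LinearEquiv.neg ℤ (M := Fin n → ℤ) = signedPermEquiv (fun _ => -1) 1 :=
    LinearEquiv.ext fun μ => by rw [signedPermEquiv_apply]; funext i; simp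
  rw [h]
  exact signedPermEquiv_mem_symplecticWeylGroup _ _

/-- `S_n ≤ W(C_n)` as subgroups of `Aut_ℤ(ℤⁿ)` (the tree's `glWeylGroup`). [cite: Satake1963, §7] -/
theorem glWeylGroup_le_symplecticWeylGroup {n : ℕ} : ConnectedReductiveGroupData.glWeylGroup n ≤ symplecticWeylGroup n := by
  unfold ConnectedReductiveGroupData.glWeylGroup
  rw [Subgroup.closure_le]
  rintro _ ⟨π, rfl⟩
  exact funCongrLeft_mem_symplecticWeylGroup π

/-- **Membership in `R[ℤⁿ]^{W(C_n)}` is invariance of the coefficients under signed permutations.** [cite: CartierCorvallis1979, §IV.2]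
[cite: Satake1963, §7] -/
theorem mem_weylInvariants_symplecticWeylGroup_iff {n : ℕ} (f : AddMonoidAlgebra R (Fin n → ℤ)) :
    f ∈ weylInvariants R (Fin n → ℤ) (symplecticWeylGroup n) ↔
      ∀ (ε : Fin n → ℤˣ) (π : Equiv.Perm (Fin n)) (μ : Fin n → ℤ), f.coeff (fun i => (ε i : ℤ) * μ (π i)) = f.coeff μ := by
  rw [mem_weylInvariants_iff]
  constructor
  · intro h ε π μ
    have h1 := (domCongr_eq_self_iff_coeff _ f).1 (h _ (signedPermEquiv_mem_symplecticWeylGroup ε π)) μ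
    change f.coeff (signedPermEquiv ε π μ) = f.coeff μ at h1
    rw [signedPermEquiv_apply] at h1
    exact h1
  · intro h w hw
    unfold symplecticWeylGroup at hw
    induction hw using Subgroup.closure_induction with
    | mem w hw =>
      obtain ⟨⟨ε, π⟩, rfl⟩ := hw
      rw [domCongr_eq_self_iff_coeff]
      intro μ
      change f.coeff (signedPermEquiv ε π μ) = f.coeff μ
      rw [signedPermEquiv_apply]
      exact h ε π μ
    | one =>
      rw [domCongr_eq_self_iff_coeff]
      intro x
      rfl
    | mul a b _ _ ha hb =>
      rw [domCongr_eq_self_iff_coeff] at ha hb ⊢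
      intro x
      exact (ha (b x)).trans (hb x)
    | inv a _ ha =>
      rw [domCongr_eq_self_iff_coeff] at ha ⊢
      intro x
      have hx := ha (a.symm x)
      change f.coeff (a (a.symm x)) = f.coeff (a.symm x) at hx
      rw [LinearEquiv.apply_symm_apply] at hx
      exact hx.symm

variable [Valued K ℤᵐ⁰] [CompactSpace 𝒪[K]] [Finite 𝓀[K]]

/-- **`𝒮_q(T) ∈ R[ℤⁿ]^{W(C_n)}`** for every `T ∈ ℋ_R(Sp_{2n}(K), Sp_{2n}(𝒪))` (`(q : R) = #𝓀` a unit): Cartier's Theorem 4.1 (b)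
for `Sp_{2n}`. [cite: CartierCorvallis1979, §IV Thm. 4.1 (b)] [cite: Satake1963, §7] [cite: AndrianovZhuravlev1995, Ch. 3 §3.3 Thm. 3.30] -/
theorem symplecticSatakeTransform_mem_weylInvariants {n : ℕ} (hϖ : Valued.v ϖ = WithZero.exp (-1 : ℤ)) (q : Rˣ)
    (hq : (q : R) = Nat.card 𝓀[K]) (T : heckeAlgebra R (symplecticGroup (Fin n) K) (symplecticInt (Fin n) K)) :
    symplecticSatakeTransform hϖ q T ∈ weylInvariants R (Fin n → ℤ) (symplecticWeylGroup n) :=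
  (mem_weylInvariants_symplecticWeylGroup_iff _).2 fun ε π μ => coeff_symplecticSatakeTransform_signedPerm hϖ q hq T ε π μ

/-- **The image of the Satake transform of `Sp_{2n}` lies in the Weyl-group invariants**: `𝒮_q(ℋ_R) ≤ R[ℤⁿ]^{W(C_n)}`.
[cite: CartierCorvallis1979, §IV Thm. 4.1 (b)] [cite: Satake1963, §7] -/
theorem range_symplecticSatakeTransform_le_weylInvariants {n : ℕ} (hϖ : Valued.v ϖ = WithZero.exp (-1 : ℤ)) (q : Rˣ)
    (hq : (q : R) = Nat.card 𝓀[K]) :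
    (symplecticSatakeTransform (n := n) (K := K) hϖ q).range ≤ weylInvariants R (Fin n → ℤ) (symplecticWeylGroup n) := by
  rintro _ ⟨T, rfl⟩
  exact symplecticSatakeTransform_mem_weylInvariants hϖ q hq T

end Literature.NumberTheory.Automorphic.SymplecticCartan

end
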